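import Summits.CriticalPhenomena.CardyFormulaZ2.Theses.CardyRotToConf
import Summits.CriticalPhenomena.CardyFormulaZ2.Theorems.CardyRotToConfR2SymmetryUpgrade.Negative.SurgCrosscutSplit
import Summits.CriticalPhenomena.CardyFormulaZ2.Theorems.CardyRotToConfR2SymmetryUpgrade.Negative.SurgJordanLocal
import Literature.Topology.PlaneTopology.CrosscutProofs
import Literature.Topology.PlaneTopology.JordanDomainLocalJoin
import Mathlib.Analysis.Convex.StrictConvexSpace
import HarnessLib

/-!
# Generalised tip separation (stub `stub_tipSeparationGen`, line `germ-label-transport`,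
# crux `CardyRotToConfR2SymmetryUpgrade`, stmt-CriticalPhenomena-0698)

Pure planar topology; generalises `stub_tipSeparation` (bookkeeping adapted from
`CardyRotToConfR2SymmetryUpgradeTipSeparation.lean`): the connected set `K ⊆ closure U` need not
contain `U.pt 0` and the tip `z = V.pt 0 ∈ K` may coincide with `U.pt 0`; instead `K` misses
`V ⊆ U` and contains some `k ≠ z`. If BOTH boundary branches of `∂V` at `z` carry
points of `∂U ∖ K` with parameters arbitrarily close to `V.mark 0`, then `False`.

Proof. Fix `0 < r < min (dist k z) (dist b z)` (`b = V.pt 1 ≠ z`). `z ∈ ∂U`, `z = U.boundary t`;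
a parameter window `(t - δ, t + δ)`, `δ ≤ 1/2`, is mapped into `ball z r`, and frontier points of
`U` close to `z` have a parameter in it (`JordanLocal.exists_radius_param_near`). Two distinct
points of `∂V` close to `z` are joined by a cross-cut of `V` inside `ball z r`
(`exists_isCrosscut_subset_ball`: image of a short chord of the closed unit disc under a
Schoenflies homeomorphism of `V`, `exists_schoenflies`, uniform continuity). Take the two free
points `p = V.boundary s`, `p' = V.boundary s'` (`s' < V.mark 0 < s`) that close to `z` and such a
cross-cut `L ⊆ ball z r` from `p'` to `p`; `K ∩ L = ∅`, `b ∉ L`. Newman in `V`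
(`Newman1939_crosscut_holds`): `V ∖ L = X₁ ⊔ X₂`, `z ∈ closure X₁`, `b ∈ closure X₂`. `L` is a
cross-cut of `U` between two parameters `u₁ < u₂` of the window; Newman in `U`:
`U ∖ L = W₁ ⊔ W₂`, `∂W₁ = L ∪ U.boundary '' [u₁, u₂] ⊆ ball z r`, so `closure W₁ ⊆ closedBall z r`
(a bounded set with frontier in a ball lies in the closed ball, the exterior being connected and
unbounded). `W₁` meets `V`, hence contains `X₁` or `X₂`: `X₂ ⊆ W₁` puts `b` in the closed ball;
`X₁ ⊆ W₁` gives `z ∈ K ∩ closure W₁`, `k ∈ K ∩ closure W₂ ∖ closure W₁`, and the connected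
`K ⊆ closure W₁ ∪ closure W₂` meets `closure W₁ ∩ closure W₂ ⊆ L` (`false_of_small_crosscut`).

References: M. H. A. Newman, *Elements of the topology of plane sets of points* (1939), Ch. V §11,
Thms. 11·7–11·8; Ch. Pommerenke, *Boundary Behaviour of Conformal Maps* (1992), §2.3 Cor. 2.8.
-/

noncomputable section

open Set Metric Topology Filter

namespace Summit.CriticalPhenomena.CardyFormulaZ2.Theorems.CardyRotToConfR2SymmetryUpgrade

open Literature.Probability.RandomPlanarGeometry
open Literature.Topology.PlaneTopology
open Summit.CriticalPhenomena.CardyFormulaZ2.Theorems.CardyRotToConfR2SymmetryUpgrade.Negative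

namespace TipSeparationGen

/-- **Small cross-cuts near a point.** Two distinct frontier points of a Jordan domain `D` close
to `z` are joined by a cross-cut of `D` inside `ball z r`: the image of the chord of the closed
unit disc between their preimages under a Schoenflies homeomorphism `ℂ ≃ₜ ℂ` of `D`
(`exists_schoenflies`), short by uniform continuity of the homeomorphism on the closed disc and
of its inverse on `closure D`; the open chord lies in the open disc by strict convexity.
[cite: PommerenkeBBCM1992, §2.3 Cor. 2.8] -/
theorem exists_isCrosscut_subset_ball (D : JordanDomain) (z : ℂ) {r : ℝ} (hr : 0 < r) :
    ∃ η > 0, ∀ p ∈ frontier D.carrier, ∀ q ∈ frontier D.carrier, p ≠ q → dist p z < η →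
      dist q z < η → ∃ L : Set ℂ, D.IsCrosscut L p q ∧ L ⊆ ball z r := by
  obtain ⟨H, hball, hsphere, hcl⟩ := exists_schoenflies D
  have hB : IsCompact (closedBall (0 : ℂ) 1) := isCompact_closedBall 0 1
  have hHuc : UniformContinuousOn H (closedBall (0 : ℂ) 1) :=
    hB.uniformContinuousOn_of_continuous H.continuous.continuousOn
  have hcl_c : IsCompact (closure D.carrier) := by rw [← hcl]; exact hB.image H.continuous
  have hSuc : UniformContinuousOn H.symm (closure D.carrier) :=
    hcl_c.uniformContinuousOn_of_continuous H.symm.continuous.continuousOn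
  rw [Metric.uniformContinuousOn_iff] at hHuc hSuc
  obtain ⟨θ, hθ, hθH⟩ := hHuc (r / 2) (half_pos hr)
  obtain ⟨η, hη, hηS⟩ := hSuc θ hθ
  refine ⟨min (η / 2) (r / 2), lt_min (half_pos hη) (half_pos hr),
    fun p hp q hq hpq hpz hqz => ?_⟩
  have hpz' : dist p z < r / 2 := lt_of_lt_of_le hpz (min_le_right _ _)
  have hpq_dist : dist p q < η :=
    calc dist p q ≤ dist p z + dist q z := dist_triangle_right p q z
      _ < η / 2 + η / 2 := add_lt_add (lt_of_lt_of_le hpz (min_le_left _ _))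
          (lt_of_lt_of_le hqz (min_le_left _ _))
      _ = η := by ring
  have hxy_dist : dist (H.symm p) (H.symm q) < θ :=
    hηS p (frontier_subset_closure hp) q (frontier_subset_closure hq) hpq_dist
  rw [← hsphere] at hp hq
  obtain ⟨x, hx, rfl⟩ := hp
  obtain ⟨y, hy, rfl⟩ := hq
  rw [H.symm_apply_apply, H.symm_apply_apply] at hxy_dist
  have hxy : x ≠ y := fun h => hpq (h ▸ rfl)
  have hxB : x ∈ closedBall (0 : ℂ) 1 := sphere_subset_closedBall hx
  have hyB : y ∈ closedBall (0 : ℂ) 1 := sphere_subset_closedBall hy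
  refine ⟨H '' segment ℝ x y, ⟨(IsSimpleArc.segment hxy).image H.continuous H.injective,
    by rw [← hsphere]; exact mem_image_of_mem H hx,
    by rw [← hsphere]; exact mem_image_of_mem H hy, hpq, ?_⟩, ?_⟩
  · rintro _ ⟨⟨w, hw, rfl⟩, hne⟩
    rw [← hball]
    refine mem_image_of_mem H (openSegment_subset_ball_of_ne hxB hyB hxy ?_)
    rw [← insert_endpoints_openSegment] at hw
    rcases hw with rfl | rfl | hw
    · exact absurd (mem_insert _ _) hne
    · exact absurd (mem_insert_of_mem _ (mem_singleton _)) hne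
    · exact hw
  · rintro _ ⟨w, hw, rfl⟩
    have hwB : w ∈ closedBall (0 : ℂ) 1 := (convex_closedBall 0 1).segment_subset hxB hyB hw
    have hwx : dist w x < θ := by
      have h : w ∈ closedBall x (dist x y) :=
        (convex_closedBall x (dist x y)).segment_subset (mem_closedBall_self dist_nonneg)
          (mem_closedBall.2 (dist_comm y x).le) hw
      exact (mem_closedBall.1 h).trans_lt hxy_dist
    have h1 : dist (H w) (H x) < r / 2 := hθH w hwB x hxB hwx
    rw [mem_ball]
    calc dist (H w) z ≤ dist (H w) (H x) + dist (H x) z := dist_triangle _ _ _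
      _ < r / 2 + r / 2 := add_lt_add h1 hpz'
      _ = r := by ring

/-- **A bounded plane set whose frontier lies in an open ball lies in the closed ball**: the
exterior `{w | r < dist w z}` of the closed ball is connected (`isConnected_setOf_lt_norm`) and
misses the frontier, so it lies in the interior (no: the set is bounded) or off the closure.
[folklore] -/
theorem subset_closedBall_of_frontier_subset_ball {W : Set ℂ} (hW : Bornology.IsBounded W)
    {z : ℂ} {r : ℝ} (hr : 0 ≤ r) (hfr : frontier W ⊆ ball z r) : W ⊆ closedBall z r := by
  -- the exterior `E` of the closed ball
  set E : Set ℂ := (fun w => w + z) '' {w : ℂ | r < ‖w‖} with hE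
  have hEc : IsPreconnected E := (isConnected_setOf_lt_norm hr).isPreconnected.image _
    (by fun_prop : Continuous fun w : ℂ => w + z).continuousOn
  have hEdist : ∀ e ∈ E, r < dist e z := by
    rintro _ ⟨w, hw, rfl⟩
    simpa [dist_eq_norm] using hw
  have hmemE : ∀ w, r < dist w z → w ∈ E := fun w hw =>
    ⟨w - z, by simpa [dist_eq_norm] using hw, sub_add_cancel w z⟩
  -- a point of `E` outside `W`
  obtain ⟨R, hR⟩ := (Metric.isBounded_iff_subset_closedBall z).1 hW
  obtain ⟨hmax₁, hmax₂⟩ := And.intro (le_max_left r R) (le_max_right r R)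
  set w₀ : ℂ := z + ((max r R + 1 : ℝ) : ℂ) with hw₀
  have hw₀d : dist w₀ z = max r R + 1 := by
    rw [hw₀, dist_eq_norm, add_sub_cancel_left, Complex.norm_real, Real.norm_eq_abs,
      abs_of_pos (by linarith)]
  have hw₀E : w₀ ∈ E := hmemE w₀ (by rw [hw₀d]; linarith)
  have hw₀W : w₀ ∉ W := fun h => by linarith [hw₀d ▸ mem_closedBall.1 (hR h)]
  -- `E` misses `frontier W`, hence lies in `interior W` or in `(closure W)ᶜ`
  have hEsub : E ⊆ interior W ∪ (closure W)ᶜ := by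
    intro e he
    by_contra h
    simp only [mem_union, mem_compl_iff, not_or, not_not] at h
    exact lt_asymm (mem_ball.1 (hfr ⟨h.2, h.1⟩)) (hEdist e he)
  rcases hEc.subset_or_subset isOpen_interior isClosed_closure.isOpen_compl
      (disjoint_compl_right.mono_left (interior_subset.trans subset_closure)) hEsub with h | h
  · exact (hw₀W (interior_subset (h hw₀E))).elim
  · exact fun w hw => mem_closedBall.2 (not_lt.1 fun hlt => h (hmemE w hlt) (subset_closure hw))

/-- **The nested small cross-cut argument** (adapted from `TipSeparation.false_of_crosscut_near`).
`L ⊆ ball z r` is a cross-cut of the Jordan domain `U` between `U.boundary u₁`, `U.boundary u₂`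
(`u₁ < u₂ < u₁ + 1`) with short arc `U.boundary '' [u₁, u₂] ⊆ ball z r`; `L` meets an open
`O ⊆ U` with `O ∖ L = X₁ ∪ X₂` preconnected pieces, `z ∈ closure X₁`, `b ∈ closure X₂`,
`dist b z > r`; `K ⊆ closure U` is preconnected, misses `L`, contains `z` and some `k` with
`dist k z > r`. Then `False`: the component `W₁` of `U ∖ L` bounded by `L` and the short arc
(Newman 1939, Thm. 11·8) has `closure W₁ ⊆ closedBall z r` and contains `X₁` or `X₂`; `X₂ ⊆ W₁`
puts `b` in the closed ball; `X₁ ⊆ W₁` makes the connected `K ⊆ closure W₁ ∪ closure W₂`, which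
meets both closed pieces (`z`, `k`), meet `closure W₁ ∩ closure W₂ ⊆ L`.
[cite: Newman1939, Ch. V §11, Thms. 11·7 and 11·8] -/
theorem false_of_small_crosscut (U : JordanDomain) {O : Set ℂ} (hO : IsOpen O)
    (hOU : O ⊆ U.carrier) {L X₁ X₂ K : Set ℂ} {u₁ u₂ r : ℝ} {z b k : ℂ}
    (hu : u₁ < u₂) (hu' : u₂ < u₁ + 1)
    (hcut : U.IsCrosscut L (U.boundary u₁) (U.boundary u₂)) (hr : 0 ≤ r)
    (harc : ∀ u ∈ Icc u₁ u₂, dist (U.boundary u) z < r) (hLr : L ⊆ ball z r)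
    (hLO : (L ∩ O).Nonempty)
    (hX : X₁ ∪ X₂ = O \ L) (hX₁ : IsPreconnected X₁) (hX₂ : IsPreconnected X₂)
    (hzX : z ∈ closure X₁) (hbX : b ∈ closure X₂) (hbr : r < dist b z)
    (hK : IsPreconnected K) (hKU : K ⊆ closure U.carrier) (hKL : Disjoint K L)
    (hzK : z ∈ K) (hkK : k ∈ K) (hkr : r < dist k z) : False := by
  obtain ⟨W₁, W₂, hW₁o, hW₂o, -, -, hWdisj, hWunion, hfW₁, hfW₂⟩ :=
    Newman1939_crosscut_holds U L u₁ u₂ hu hu' hcut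
  have hW₁U : W₁ ⊆ U.carrier := fun x hx => (hWunion.subset (Or.inl hx)).1
  -- `∂W₁ ⊆ ball z r`, hence `closure W₁ ⊆ closedBall z r`
  have hfr : frontier W₁ ⊆ ball z r := by
    rw [hfW₁]
    rintro x (hx | ⟨u, hu12, rfl⟩)
    · exact hLr hx
    · exact mem_ball.2 (harc u hu12)
  have hW₁r : closure W₁ ⊆ closedBall z r :=
    closure_minimal (subset_closedBall_of_frontier_subset_ball (U.isBounded.subset hW₁U) hr hfr)
      isClosed_closedBall
  -- `W₁` meets `O`: an interior point of `L ⊆ ∂W₁` lies in the open set `O`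
  obtain ⟨w, hwL, hwO⟩ := hLO
  have hwW : w ∈ closure W₁ := by
    rw [closure_eq_self_union_frontier, hfW₁]
    exact Or.inr (Or.inl hwL)
  obtain ⟨v, hvO, hvW⟩ := _root_.mem_closure_iff.1 hwW O hO hwO
  have hvL : v ∉ L := (hWunion.subset (Or.inl hvW)).2
  have hvX : v ∈ X₁ ∪ X₂ := by
    rw [hX]
    exact ⟨hvO, hvL⟩
  -- the pieces of `O ∖ L` lie in `W₁ ∪ W₂`
  have hXW : X₁ ∪ X₂ ⊆ W₁ ∪ W₂ := by
    rw [hX, hWunion]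
    exact sdiff_subset_sdiff_left hOU
  rcases hvX with hv | hv
  · -- `X₁ ⊆ W₁`: `K` would be trapped in `closure W₁ ⊆ closedBall z r`
    have hX₁W : X₁ ⊆ W₁ := by
      rcases hX₁.subset_or_subset hW₁o hW₂o hWdisj (subset_union_left.trans hXW) with h | h
      · exact h
      · exact absurd (h hv) (Set.disjoint_left.1 hWdisj hvW)
    have hzW : z ∈ closure W₁ := closure_mono hX₁W hzX
    -- the closures of `W₁`, `W₂` cover `closure U`
    have hcover : closure U.carrier ⊆ closure W₁ ∪ closure W₂ := by
      intro x hx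
      rw [closure_eq_self_union_frontier] at hx
      rcases hx with hx | hx
      · by_cases hxL : x ∈ L
        · exact Or.inl (by rw [closure_eq_self_union_frontier, hfW₁]; exact Or.inr (Or.inl hxL))
        · have h : x ∈ W₁ ∪ W₂ := by rw [hWunion]; exact ⟨hx, hxL⟩
          exact h.imp (fun h => subset_closure h) (fun h => subset_closure h)
      · rw [U.frontier_eq_union_image_boundary u₁ u₂] at hx
        rcases hx with hx | hx
        · left
          rw [closure_eq_self_union_frontier, hfW₁]
          exact Or.inr (Or.inr hx)
        · right
          rw [closure_eq_self_union_frontier, hfW₂]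
          exact Or.inr (Or.inr hx)
    -- the two closures intersect inside `L`
    have hinter : closure W₁ ∩ closure W₂ ⊆ L := by
      intro x ⟨hx₁, hx₂⟩
      by_contra hxL
      have hxW₁ : x ∉ W₁ := fun hx => Set.disjoint_left.1 (hWdisj.closure_right hW₁o) hx hx₂
      have hxW₂ : x ∉ W₂ := fun hx =>
        Set.disjoint_left.1 (hWdisj.symm.closure_right hW₂o) hx hx₁
      rw [closure_eq_self_union_frontier, hfW₁] at hx₁
      rw [closure_eq_self_union_frontier, hfW₂] at hx₂
      have hx₁' : x ∈ U.boundary '' Icc u₁ u₂ := by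
        rcases hx₁ with h | h | h
        · exact absurd h hxW₁
        · exact absurd h hxL
        · exact h
      have hx₂' : x ∈ U.boundary '' Icc u₂ (u₁ + 1) := by
        rcases hx₂ with h | h | h
        · exact absurd h hxW₂
        · exact absurd h hxL
        · exact h
      rcases U.image_boundary_inter_subset hu hu' ⟨hx₁', hx₂'⟩ with h | h
      · exact hxL (by rw [h]; exact hcut.1.left_mem)
      · exact hxL (by rw [mem_singleton_iff.1 h]; exact hcut.1.right_mem)
    have hkW₁ : k ∉ closure W₁ := fun h => (not_le.2 hkr) (mem_closedBall.1 (hW₁r h))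
    have hkW₂ : k ∈ closure W₂ := (hcover (hKU hkK)).resolve_left hkW₁
    obtain ⟨x, hxK, hx⟩ := isPreconnected_closed_iff.1 hK _ _ isClosed_closure isClosed_closure
      (hKU.trans hcover) ⟨z, hzK, hzW⟩ ⟨k, hkK, hkW₂⟩
    exact Set.disjoint_left.1 hKL hxK (hinter hx)
  · -- `X₂ ⊆ W₁`: the point `b` would be in the small closed ball
    have hX₂W : X₂ ⊆ W₁ := by
      rcases hX₂.subset_or_subset hW₁o hW₂o hWdisj (subset_union_right.trans hXW) with h | h
      · exact h
      · exact absurd (h hv) (Set.disjoint_left.1 hWdisj hvW)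
    exact (not_le.2 hbr) (mem_closedBall.1 (hW₁r (closure_mono hX₂W hbX)))

end TipSeparationGen

open TipSeparationGen in
/-- **S7d'. Generalised tip separation** (pure planar topology). `V ⊆ U` Dobrushin domains with
the same target, `K ⊆ closure U` connected, containing the tip `V.pt 0` and some other point,
disjoint from `V` (the past of a curve — which may have returned to its starting point — and the
target-side remaining domain). If BOTH boundary branches of `V` at `V.pt 0` contain points of
`∂U ∖ K` arbitrarily close to the mark (in parameter), contradiction: a SHORT cross-cut `L` of `V`
between two such points close to the tip (Schoenflies, uniform continuity) is a cross-cut of `U`;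
by Newman's cross-cut theorem (`Newman1939_crosscut_holds`, in `V` and in `U`) the piece of
`U ∖ L` adjacent to the tip has frontier `L ∪` (short arc of `∂U`) inside a small ball about the
tip, hence lies in that ball, and so does the connected `K` (missing `L`, containing the tip) —
impossible as `K` has a point far from the tip; the other alternative puts `V.pt 1` in the ball.
[cite: Newman1939, Ch. V §11, Thms. 11·7 and 11·8] -/
theorem stub_tipSeparationGen :
    ∀ (U V : DobrushinDomain) (K : Set ℂ), V.carrier ⊆ U.carrier → V.pt 1 = U.pt 1 →
      IsConnected K → K ⊆ closure U.carrier → V.pt 0 ∈ K → (∃ k ∈ K, k ≠ V.pt 0) →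
      Disjoint K V.carrier →
      (∀ ε : ℝ, 0 < ε →
        (∃ s ∈ Set.Ioo (V.mark 0) (V.mark 0 + ε),
          V.boundary s ∈ frontier U.carrier ∧ V.boundary s ∉ K) ∧
        (∃ s ∈ Set.Ioo (V.mark 0 - ε) (V.mark 0),
          V.boundary s ∈ frontier U.carrier ∧ V.boundary s ∉ K)) →
      False := by
  intro U V K hVU _ hK hKU hzK hk hKV hε
  obtain ⟨k, hkK, hkz⟩ := hk
  have hzdef : V.pt 0 = V.boundary (V.mark 0) := rfl
  have hbdef : V.pt 1 = V.boundary (V.mark 1) := rfl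
  have hm01 : V.mark 0 < V.mark 1 := mark_zero_lt_mark_one V
  have hm10 : V.mark 1 < V.mark 0 + 1 := mark_one_lt_mark_zero_add_one V
  have hcont : ContinuousAt V.boundary (V.mark 0) := V.continuous_boundary.continuousAt
  -- the tip is on `∂U`
  have hzF : V.pt 0 ∈ frontier U.carrier := by
    have h : V.pt 0 ∈ closure (frontier U.carrier) := by
      rw [Metric.mem_closure_iff]
      intro r hr
      obtain ⟨η, hη, hηr⟩ := Metric.continuousAt_iff.1 hcont r hr
      obtain ⟨⟨s, hs, hsF, -⟩, -⟩ := hε η hη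
      refine ⟨V.boundary s, hsF, ?_⟩
      rw [hzdef, dist_comm]
      exact hηr (by rw [Real.dist_eq, abs_lt]; constructor <;> linarith [hs.1, hs.2])
    rwa [isClosed_frontier.closure_eq] at h
  -- the radius `r`: smaller than the distances from the tip to `k` and to the target
  have hbz : V.pt 1 ≠ V.pt 0 := V.pt_injective.ne (by decide)
  have hmin : 0 < min (dist k (V.pt 0)) (dist (V.pt 1) (V.pt 0)) :=
    lt_min (dist_pos.2 hkz) (dist_pos.2 hbz)
  obtain ⟨r, hr, hrk, hrb⟩ : ∃ r : ℝ, 0 < r ∧ r < dist k (V.pt 0) ∧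
      r < dist (V.pt 1) (V.pt 0) := ⟨_, half_pos hmin,
    (half_lt_self hmin).trans_le (min_le_left _ _), (half_lt_self hmin).trans_le (min_le_right _ _)⟩
  -- a parameter `t` of the tip on `∂U` and the window `δ`, mapped into `ball z r`
  obtain ⟨t, htz⟩ : V.pt 0 ∈ range U.boundary := by rw [U.range_boundary]; exact hzF
  obtain ⟨δ, hδ, hδ1, hδr⟩ : ∃ δ : ℝ, 0 < δ ∧ δ ≤ 1 / 2 ∧
      ∀ u, dist u t < δ → dist (U.boundary u) (V.pt 0) < r := by
    obtain ⟨δ₀, hδ₀, h⟩ :=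
      Metric.continuousAt_iff.1 (U.continuous_boundary.continuousAt (x := t)) r hr
    refine ⟨min δ₀ (1 / 2), lt_min hδ₀ (by norm_num), min_le_right _ _, fun u hu => ?_⟩
    rw [← htz]
    exact h (lt_of_lt_of_le hu (min_le_left _ _))
  have harc : ∀ u₁ ∈ Ioo (t - δ) (t + δ), ∀ u₂ ∈ Ioo (t - δ) (t + δ), ∀ u ∈ Icc u₁ u₂,
      dist (U.boundary u) (V.pt 0) < r := fun u₁ hu₁ u₂ hu₂ u hu =>
    hδr u (by rw [Real.dist_eq, abs_lt]; constructor <;> linarith [hu.1, hu.2, hu₁.1, hu₂.2])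
  -- frontier points of `U` near the tip have a parameter in the window
  obtain ⟨ρ, hρ, hnear⟩ := JordanLocal.exists_radius_param_near U.toJordanDomain t hδ hδ1
  -- small cross-cuts of `V` near the tip
  obtain ⟨η₁, hη₁, hsmall⟩ := exists_isCrosscut_subset_ball V.toJordanDomain (V.pt 0) hr
  -- the two free points, close to the tip
  obtain ⟨η, hη, hηr⟩ := Metric.continuousAt_iff.1 hcont (min ρ η₁) (lt_min hρ hη₁)
  have hε₁ := min_le_left η (min (V.mark 1 - V.mark 0) (V.mark 0 + 1 - V.mark 1))
  have hε₂ := min_le_right η (min (V.mark 1 - V.mark 0) (V.mark 0 + 1 - V.mark 1))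
  have hε₃ := min_le_left (V.mark 1 - V.mark 0) (V.mark 0 + 1 - V.mark 1)
  have hε₄ := min_le_right (V.mark 1 - V.mark 0) (V.mark 0 + 1 - V.mark 1)
  obtain ⟨⟨s, hs, hsF, hsK⟩, ⟨s', hs', hs'F, hs'K⟩⟩ :=
    hε (min η (min (V.mark 1 - V.mark 0) (V.mark 0 + 1 - V.mark 1)))
      (lt_min hη (lt_min (by linarith) (by linarith)))
  have h₁ : s' < V.mark 0 := hs'.2
  have h₂ : V.mark 0 < s := hs.1
  have h₃ : s < V.mark 1 := by linarith [hs.2]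
  have h₄ : V.mark 1 < s' + 1 := by linarith [hs'.1]
  have hs's : s' < s := h₁.trans h₂
  have hss' : s < s' + 1 := by linarith
  have hds : dist (V.boundary s) (V.pt 0) < min ρ η₁ := by
    rw [hzdef]
    exact hηr (by rw [Real.dist_eq, abs_lt]; constructor <;> linarith [hs.1, hs.2])
  have hds' : dist (V.boundary s') (V.pt 0) < min ρ η₁ := by
    rw [hzdef]
    exact hηr (by rw [Real.dist_eq, abs_lt]; constructor <;> linarith [hs'.1, hs'.2])
  -- injectivity of `V.boundary` on the period `[s', s' + 1)`
  have hinj := V.injOn_boundary_Ico s'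
  have hmem_s : s ∈ Ico s' (s' + 1) := ⟨hs's.le, hss'⟩
  have hmem_s' : s' ∈ Ico s' (s' + 1) := ⟨le_rfl, by linarith⟩
  have hpp' : V.boundary s' ≠ V.boundary s := fun h => hs's.ne (hinj hmem_s' hmem_s h)
  -- a small cross-cut of `V` between the two free points
  obtain ⟨L, hLV, hLr⟩ := hsmall _ (V.boundary_mem_frontier s') _ (V.boundary_mem_frontier s)
    hpp' (lt_of_lt_of_le hds' (min_le_right _ _)) (lt_of_lt_of_le hds (min_le_right _ _))
  have hLsub : L \ {V.boundary s', V.boundary s} ⊆ V.carrier := hLV.2.2.2.2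
  have hoffL : ∀ x ∈ L, x ≠ V.boundary s' → x ≠ V.boundary s → x ∈ V.carrier :=
    fun x hxL hx₁ hx₂ => hLsub ⟨hxL, by
      simp only [mem_insert_iff, mem_singleton_iff, not_or]; exact ⟨hx₁, hx₂⟩⟩
  have hKL : Disjoint K L := by
    rw [Set.disjoint_left]
    intro x hxK hxL
    exact Set.disjoint_left.1 hKV hxK
      (hoffL x hxL (fun h => hs'K (h ▸ hxK)) (fun h => hsK (h ▸ hxK)))
  have hbL : V.pt 1 ∉ L := fun h => lt_asymm (mem_ball.1 (hLr h)) hrb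
  have hLO : (L ∩ V.carrier).Nonempty := by
    -- an interior point of the arc, e.g. the image of the parameter `1/2`
    obtain ⟨γ, -, hγinj, hγL, hγ0, hγ1⟩ := hLV.1
    have hm : (1 / 2 : ℝ) ∈ Icc (0 : ℝ) 1 := ⟨by norm_num, by norm_num⟩
    have hxL : γ (1 / 2) ∈ L := hγL ▸ mem_image_of_mem γ hm
    refine ⟨γ (1 / 2), hxL, hoffL _ hxL (fun h => ?_) (fun h => ?_)⟩
    · have := hγinj hm (left_mem_Icc.2 zero_le_one) (h.trans hγ0.symm)
      norm_num at this
    · have := hγinj hm (right_mem_Icc.2 zero_le_one) (h.trans hγ1.symm)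
      norm_num at this
  -- Newman in `V`: the tip and the target are on the two sides
  obtain ⟨X₁, X₂, -, -, hX₁c, hX₂c, -, hXunion, hfX₁, hfX₂⟩ :=
    Newman1939_crosscut_holds V.toJordanDomain L s' s hs's hss' hLV
  have hzX : V.pt 0 ∈ closure X₁ := by
    refine frontier_subset_closure ?_
    rw [hfX₁, hzdef]
    exact Or.inr ⟨V.mark 0, ⟨h₁.le, h₂.le⟩, rfl⟩
  have hbX : V.pt 1 ∈ closure X₂ := by
    refine frontier_subset_closure ?_
    rw [hfX₂, hbdef]
    exact Or.inr ⟨V.mark 1, ⟨h₃.le, h₄.le⟩, rfl⟩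
  -- parameters of the two free points on `∂U`, and the nested small cross-cut argument
  obtain ⟨u, hu, hup⟩ := hnear _ hsF (by rw [htz]; exact lt_of_lt_of_le hds (min_le_left _ _))
  obtain ⟨u', hu', hup'⟩ :=
    hnear _ hs'F (by rw [htz]; exact lt_of_lt_of_le hds' (min_le_left _ _))
  have huu' : u ≠ u' := fun h => hpp' (by rw [← hup, ← hup', h])
  rcases lt_or_gt_of_ne huu' with hlt | hlt
  · have hcut : U.IsCrosscut L (U.boundary u) (U.boundary u') := by
      rw [hup, hup']
      refine ⟨hLV.1.symm, hsF, hs'F, hpp'.symm, ?_⟩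
      rw [Set.pair_comm]
      exact hLsub.trans hVU
    exact false_of_small_crosscut U.toJordanDomain V.isOpen hVU hlt
      (by linarith [hu.1, hu'.2]) hcut hr.le (harc u hu u' hu') hLr hLO hXunion
      hX₁c.isPreconnected hX₂c.isPreconnected hzX hbX hrb hK.isPreconnected hKU hKL hzK hkK hrk
  · have hcut : U.IsCrosscut L (U.boundary u') (U.boundary u) := by
      rw [hup, hup']
      exact ⟨hLV.1, hs'F, hsF, hpp', hLsub.trans hVU⟩
    exact false_of_small_crosscut U.toJordanDomain V.isOpen hVU hlt
      (by linarith [hu'.1, hu.2]) hcut hr.le (harc u' hu' u hu) hLr hLO hXunion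
      hX₁c.isPreconnected hX₂c.isPreconnected hzX hbX hrb hK.isPreconnected hKU hKL hzK hkK hrk

end Summit.CriticalPhenomena.CardyFormulaZ2.Theorems.CardyRotToConfR2SymmetryUpgrade
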